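import Summits.BirchSwinnertonDyer.BirchSwinnertonDyer.Theorems.CyclotomicUntwistPSLocalThreeTorsionII
import HarnessLib

/-!
# The Kodaira-`IV*` rows (`v₃Δ_min = 10`) are a ONE-STABLE-LINE locus at `3`, of shape ORD:
# ORDM (line `≅ μ₃ ⊗ unramified quadratic`) iff `c₆(W_ℤ)/3⁶ ≡ 1 (mod 3)`, ORD1 (line `≅ μ₃`) iff `≡ 2`

Cell `pub/bsd-wall` (D-0145 line `route-BirchSwinnertonDyer-CyclotomicUntwist`), seat `bsd-line-cycu-p2`
(prover seat 2/3, gen 3), helper toward K1 `PSRankOneLowerHalfAtThree` (stmt-BirchSwinnertonDyer-21580) and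
K2 `PSRankOneUpperHalfAtThree` (stmt-21581): the local residual shape `W[3]|G_{ℚ₃}` on the principal-series
rows, in o6-r1's six-shape vocabulary (`Additive/WildThreeResidualShape.lean`). THEOREMS ONLY (no definition,
no named fact, no `sorry`); BSD is not proved by this file and no crux is.

With `…PSLocalThreeTorsionII.lean` (`II`), `…Et.lean` (`IV`) and this file (`IV*`), three of the four cyclic
wild rows carry EXACTLY ONE `G_{ℚ₃}`-stable line, read in Kraus currency:
* `II` (`v = 4`) and `IV` (`v = 6`): ET-side; ET1 (`W(ℚ₃)[3] ≠ 0`) iff `c₆/3^{v₃c₆} ≡ 1 (mod 3)`, else ETM;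
* `IV*` (`v = 10`): ORD-side (THIS FILE); ORDM iff `c₆/3⁶ ≡ 1 (mod 3)`, ORD1 iff `c₆/3⁶ ≡ 2 (mod 3)` — and by
  this seat's LAW L-c3 (`c₃ = 3 ⟺ (Δ_min/3¹⁰)(c₆/3⁶) ≡ 1`), on the PS rows (`Δ_min/3¹⁰ ≡ 1`) ORDM ⟺ `c₃ = 3`.
(`II*`, `v = 12`: ORD-side parity `v₃c₆ = 8`; uniqueness of its `ℚ₃`-root is not treated here.)

## Method (`IV*`, `v(Δ) = 10`, `π = 3`)
On Tate's Step-8 normal form over `K_v` (`b₂ = π²β₂`, `b₄ = π³β₄`, `b₆ = π⁴β₆`, `β₆` a unit, `Δ = π¹⁰δ`)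
`w b₈ = e⁻⁶` (`map_b₈_of_shapeIVstar_ten`), and the rescaling `cᵢ = bᵢ/π^{i/2}`, `r = z/π` puts every root on
the type-III shape (as in `eval_Ψ₂Sq_ne_sq_of_shapeIVstar_ten`), where `NonSplitAtThree.root_eq_root_of_shapeIII`
gives uniqueness. Existence of a `ℚ₃`-root: `exists_isRoot_Ψ₃_padic_of_le` (`v₃c₆ = 6`, `v₃c₄ ≥ 4`:
`12 ≤ 13`). The ORD readings are V10's `shapeORDMThree_iff` / `shapeORD1Three_iff` plus the `ℚ₃` square class
of the integer `c₆` (`isSquare_intCast_padic_three_iff`, exponent `6`).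
References: J. H. Silverman, *Advanced Topics* (1994), IV.9.4 Step 8 [SilvermanATAEC1994]; J.-P. Serre,
Invent. Math. 15 (1972), §1.11 [Serre1972]; A. Kraus, Manuscripta Math. 69 (1990), Théorème (p = 3) [Kraus1990].
-/

set_option autoImplicit false
-- single-conjunct summit: `Summit.BirchSwinnertonDyer.BirchSwinnertonDyer.…` repeats the name by design
set_option linter.dupNamespace false

noncomputable section

open scoped Classical

open Polynomial WeierstrassCurve IsDedekindDomain IsDedekindDomain.HeightOneSpectrum WithZero
  Rat.HeightOneSpectrum Literature.NumberTheory.EllipticCurves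
  Literature.NumberTheory.EllipticCurves.Rank1Residual Literature.NumberTheory.DiophantineGeometry
  Summit.BirchSwinnertonDyer.Rank1Residual.Additive Summit.BirchSwinnertonDyer.Rank1Residual.O5
  Summit.BirchSwinnertonDyer.Rank1Residual.O5.NonSplitAtThree
  Summit.BirchSwinnertonDyer.Rank1Residual.Additive.PsiThreeAdic
  Summit.BirchSwinnertonDyer.Rank1Residual.GaloisImage.LocalTorsion3

namespace Summit.BirchSwinnertonDyer.BirchSwinnertonDyer.Theorems.PSLocalThreeTorsion

/-! ## §1 Over the completion `K_v`: `Ψ₃` has at most one root on the type-`IV*` shape with `v(Δ) = 10` -/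

section Completion

variable {A : Type*} [CommRing A] [IsDedekindDomain A] {K : Type*} [Field K] [Algebra A K]
  [IsFractionRing A K] (v : HeightOneSpectrum A)

/-- **Type `IV*` with `v(Δ) = 10`: `Ψ₃` has at most one root in `K_v`.** On a `K_v`-model with
`b₂ = π²β₂`, `b₄ = π³β₄`, `b₆ = π⁴β₆` (`β₆` a unit), `Δ = π¹⁰δ` (`δ` a unit), `π = 3`: the rescaled invariants
`bᵢ/π^{i/2}` are on the type-III shape and `r = z/π` solves the rescaled `Ψ₃`, so two roots `z, z'` have
`z/π = z'/π`. [cite: SilvermanATAEC1994, IV.9.4 Step 8 (normal form of type IV*)] -/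
theorem Ψ₃_root_unique_of_shapeIVstar_ten {π : K} (hπ : v.valuation K π = exp (-1 : ℤ))
    (h3 : (π : v.adicCompletion K) = 3) (N : WeierstrassCurve (v.adicCompletion K))
    (β₂ β₄ β₆ δ : v.adicCompletionIntegers K) (hβ₆ : IsUnit β₆) (hδ : IsUnit δ)
    (hb₂ : N.b₂ = (π : v.adicCompletion K) ^ 2 * β₂)
    (hb₄ : N.b₄ = (π : v.adicCompletion K) ^ 3 * β₄)
    (hb₆ : N.b₆ = (π : v.adicCompletion K) ^ 4 * β₆)
    (hΔ : N.Δ = (π : v.adicCompletion K) ^ 10 * δ) (z z' : v.adicCompletion K)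
    (hz : N.Ψ₃.eval z = 0) (hz' : N.Ψ₃.eval z' = 0) : z = z' := by
  set w : Valuation (v.adicCompletion K) ℤᵐ⁰ := Valued.v with hw
  set ϖ : v.adicCompletion K := (π : v.adicCompletion K) with hϖ
  have hπv : w ϖ = exp (-1 : ℤ) := by rw [hw, hϖ, valuedAdicCompletion_eq_valuation', hπ]
  have hϖ0 : ϖ ≠ 0 := by
    intro h0; rw [h0, map_zero] at hπv; exact exp_ne_zero hπv.symm
  have hint : ∀ β : v.adicCompletionIntegers K, w (β : v.adicCompletion K) ≤ 1 := fun β ↦ β.2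
  have hunit : ∀ {β : v.adicCompletionIntegers K}, IsUnit β → w (β : v.adicCompletion K) = 1 :=
    fun hβ ↦ valued_coe_eq_one_of_isUnit v hβ
  have h3' : (3 : v.adicCompletion K) = ϖ := h3.symm
  have hpowle : ∀ (n : ℕ) (β : v.adicCompletionIntegers K),
      w (ϖ ^ n * (β : v.adicCompletion K)) ≤ exp (-(n : ℤ)) := by
    intro n β
    rw [map_mul, map_pow, hπv, ← exp_nsmul]
    calc exp (n • (-1 : ℤ)) * w (β : v.adicCompletion K) ≤ exp (n • (-1 : ℤ)) * 1 :=
        mul_le_mul' le_rfl (hint β)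
      _ = exp (-(n : ℤ)) := by simp
  have hpoweq : ∀ (n : ℕ) {β : v.adicCompletionIntegers K}, IsUnit β →
      w (ϖ ^ n * (β : v.adicCompletion K)) = exp (-(n : ℤ)) := by
    intro n β hβ
    rw [map_mul, map_pow, hπv, ← exp_nsmul, hunit hβ, mul_one]; simp
  have wb₂ : w N.b₂ ≤ exp (-2 : ℤ) := by rw [hb₂]; exact hpowle 2 β₂
  have wb₄ : w N.b₄ ≤ exp (-3 : ℤ) := by rw [hb₄]; exact hpowle 3 β₄
  have wb₆ : w N.b₆ = exp (-4 : ℤ) := by rw [hb₆]; exact hpoweq 4 hβ₆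
  have wΔ : w (-N.b₂ ^ 2 * N.b₈ - 8 * N.b₄ ^ 3 - 27 * N.b₆ ^ 2 + 9 * N.b₂ * N.b₄ * N.b₆) =
      exp (-10 : ℤ) := by
    rw [show -N.b₂ ^ 2 * N.b₈ - 8 * N.b₄ ^ 3 - 27 * N.b₆ ^ 2 + 9 * N.b₂ * N.b₄ * N.b₆ = N.Δ from rfl,
      hΔ]
    exact hpoweq 10 hδ
  have wb₈ : w N.b₈ = exp (-6 : ℤ) := map_b₈_of_shapeIVstar_ten w h3' hπv wb₂ wb₄ wb₆ N.b_relation wΔ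
  -- the rescaled invariants `cᵢ = bᵢ / ϖ^{i/2}` are on the type-III shape
  set c₂ : v.adicCompletion K := N.b₂ / ϖ with hc₂
  set c₄ : v.adicCompletion K := N.b₄ / ϖ ^ 2 with hc₄
  set c₆ : v.adicCompletion K := N.b₆ / ϖ ^ 3 with hc₆
  set c₈ : v.adicCompletion K := N.b₈ / ϖ ^ 4 with hc₈
  have wdivid : ∀ (x : v.adicCompletion K) (n : ℕ), w (x / ϖ ^ n) = w x * exp (n : ℤ) := by
    intro x n
    rw [map_div₀, map_pow, hπv, ← exp_nsmul, div_eq_mul_inv, ← exp_neg]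
    congr 2
    simp
  have wdiv : ∀ (x : v.adicCompletion K) (n : ℕ) (a b : ℤ), a + n = b → w x ≤ exp a →
      w (x / ϖ ^ n) ≤ exp b := by
    intro x n a b hab hx
    rw [wdivid, ← hab, exp_add]
    exact mul_le_mul' hx le_rfl
  have wdiveq : ∀ (x : v.adicCompletion K) (n : ℕ) (a b : ℤ), a + n = b → w x = exp a →
      w (x / ϖ ^ n) = exp b := by
    intro x n a b hab hx
    rw [wdivid, ← hab, exp_add, hx]
  have wc₂ : w c₂ ≤ exp (-1 : ℤ) := by
    have h := wdiv N.b₂ 1 (-2) (-1) (by norm_num) wb₂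
    rwa [pow_one] at h
  have wc₄ : w c₄ ≤ exp (-1 : ℤ) := wdiv N.b₄ 2 (-3) (-1) (by norm_num) wb₄
  have wc₆ : w c₆ ≤ exp (-1 : ℤ) := (wdiveq N.b₆ 3 (-4) (-1) (by norm_num) wb₆).le
  have wc₈ : w c₈ = exp (-2 : ℤ) := wdiveq N.b₈ 4 (-6) (-2) (by norm_num) wb₈
  have hresc : ∀ y : v.adicCompletion K, N.Ψ₃.eval y = 0 →
      3 * (y / ϖ) ^ 4 + c₂ * (y / ϖ) ^ 3 + 3 * c₄ * (y / ϖ) ^ 2 + 3 * c₆ * (y / ϖ) + c₈ = 0 := by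
    intro y hy
    rw [WeierstrassCurve.eval_Ψ₃_eq] at hy
    have h : 3 * (y / ϖ) ^ 4 + c₂ * (y / ϖ) ^ 3 + 3 * c₄ * (y / ϖ) ^ 2 + 3 * c₆ * (y / ϖ) + c₈ =
        (3 * y ^ 4 + N.b₂ * y ^ 3 + 3 * N.b₄ * y ^ 2 + 3 * N.b₆ * y + N.b₈) / ϖ ^ 4 := by
      rw [hc₈, hc₂, hc₆, hc₄]
      field_simp
    rw [h, hy, zero_div]
  have heq : z / ϖ = z' / ϖ :=
    root_eq_root_of_shapeIII w h3' hπv wc₂ wc₄ wc₆ wc₈ (hresc z hz) (hresc z' hz')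
  have := congrArg (· * ϖ) heq
  simpa [div_mul_cancel₀ _ hϖ0] using this

end Completion

/-! ## §2 Curves over `ℚ`: the Kodaira-`IV*` rows (`v₃Δ_min = 10`) -/

section Curves

variable (W : WeierstrassCurve ℚ) [W.IsElliptic]

/-- **Kodaira `IV*` at `3` with `ord₃ Δ_min = 10` ⟹ `Ψ₃` has at most one root in `ℚ_{(3)}`.**
[cite: SilvermanATAEC1994, IV.9.4 Step 8 and Table 4.1] -/
theorem Ψ₃_root_unique_adicCompletion_of_kodairaIVstar
    (hT : W.kodairaSymbolAt (placeOf 3) = .IVstar) (hord : W.ordMinimalDiscriminant (placeOf 3) = 10)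
    (x y : (placeOf 3).adicCompletion ℚ)
    (hx : (W.baseChange ((placeOf 3).adicCompletion ℚ)).Ψ₃.eval x = 0)
    (hy : (W.baseChange ((placeOf 3).adicCompletion ℚ)).Ψ₃.eval y = 0) : x = y := by
  haveI : PerfectField (IsLocalRing.ResidueField ((placeOf 3).adicCompletionIntegers ℚ)) :=
    PerfectField.ofFinite
  have h2 : ringChar (ℤ ⧸ (placeOf 3).asIdeal) ≠ 2 := by rw [ringChar_int_quot_placeOf 3]; decide
  have hgen : natGenerator (placeOf 3) = 3 :=
    Literature.NumberTheory.EllipticCurves.Rat.natGenerator_primesEquiv_symm ⟨3, Nat.prime_three⟩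
  have hπ : (placeOf 3).valuation ℚ (3 : ℚ) = exp (-1 : ℤ) := by
    have h := valuation_natGenerator_int (placeOf 3)
    rwa [hgen, Nat.cast_ofNat] at h
  have h3 : algebraMap ℚ ((placeOf 3).adicCompletion ℚ) 3 = 3 := map_ofNat _ 3
  obtain ⟨C, β₂, β₄, β₆, δ, hβ₆, hδ, hb₂, hb₄, hb₆, hΔ⟩ :=
    W.exists_variableChange_b_of_kodairaSymbolAt_wild (placeOf 3) h2
      (Or.inr (Or.inr (Or.inl ⟨hT, rfl, rfl, rfl⟩))) hπ
  rw [hord] at hΔ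
  exact Ψ₃_root_unique_of_variableChange _ C
    (Ψ₃_root_unique_of_shapeIVstar_ten (placeOf 3) hπ h3 _ β₂ β₄ β₆ δ hβ₆ hδ hb₂ hb₄ hb₆ hΔ) x y hx hy

/-- **Kodaira `IV*` at `3` with `ord₃ Δ_min = 10` ⟹ `Ψ₃` has at most one root in `ℚ₃`** (transport along
`Padic.adicCompletionEquiv`). [cite: SilvermanATAEC1994, IV.9.4 Step 8] -/
theorem Ψ₃_root_unique_padic_of_kodairaIVstar
    (hT : W.kodairaSymbolAt (placeOf 3) = .IVstar) (hord : W.ordMinimalDiscriminant (placeOf 3) = 10)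
    (r s : ℚ_[3]) (hr : ((W.baseChange ℚ_[3]).Ψ₃).IsRoot r) (hs : ((W.baseChange ℚ_[3]).Ψ₃).IsRoot s) :
    r = s := by
  set Kv := (placeOf 3).adicCompletion ℚ
  let e : ℚ_[3] ≃ₐ[ℚ] Kv := (Padic.adicCompletionEquiv ℤ ⟨3, Nat.prime_three⟩).toAlgEquiv
  have he : ∀ c : ℚ_[3], ((W.baseChange ℚ_[3]).Ψ₃).IsRoot c → (W.baseChange Kv).Ψ₃.eval (e c) = 0 := by
    intro c hc
    rw [IsRoot.def, WeierstrassCurve.baseChange, map_Ψ₃, eval_map, ← aeval_def] at hc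
    rw [WeierstrassCurve.baseChange, map_Ψ₃, eval_map, ← aeval_def, aeval_algHom_apply, hc, map_zero]
  exact e.injective
    (Ψ₃_root_unique_adicCompletion_of_kodairaIVstar W hT hord (e r) (e s) (he r hr) (he s hs))

variable [W.IsGloballyMinimal]

/-- `v₃ c₆(W) = 6` on the Kodaira-`IV*` rows with `v₃Δ_min = 10`, in `padicValRat` currency. [cite: Kraus1990, Théorème (p = 3)] -/
theorem padicValRat_c₆_eq_six_of_kodairaIVstar (hK : W.kodairaSymbolAt (placeOf 3) = .IVstar)
    (hv : padicValInt 3 W.minimalDiscriminantInt = 10) : padicValRat 3 W.c₆ = 6 := by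
  rw [← cast_integralModelInt_c₆, padicValRat.of_int]
  exact_mod_cast PSTamagawaThree.padicValInt_c₆_eq_six_of_kodairaIVstar W hK hv

/-- `c₄ ≠ 0`, `c₆ ≠ 0` and `v₃ c₄ ≥ 4` on the Kodaira-`IV*` rows with `v₃Δ_min = 10` (`c₄³ = c₆² + 1728Δ`:
valuations `12` and `13` on the right). [cite: SilvermanAEC2009, III.1 (c-relation)] -/
theorem c₄_c₆_of_kodairaIVstar (hK : W.kodairaSymbolAt (placeOf 3) = .IVstar)
    (hv : padicValInt 3 W.minimalDiscriminantInt = 10) :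
    W.c₄ ≠ 0 ∧ W.c₆ ≠ 0 ∧ 4 ≤ padicValRat 3 W.c₄ := by
  have hv6 := padicValRat_c₆_eq_six_of_kodairaIVstar W hK hv
  have h₆ : W.c₆ ≠ 0 := by
    intro h0
    have h5 := PSTamagawaThree.padicValInt_c₆_eq_six_of_kodairaIVstar W hK hv
    have hz : (integralModelInt W).c₆ = 0 := by
      have := cast_integralModelInt_c₆ W
      rw [h0] at this
      exact_mod_cast this
    rw [hz] at h5
    simp at h5
  have hΔ : W.Δ ≠ 0 := W.coe_Δ' ▸ W.Δ'.ne_zero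
  have hvΔ : padicValRat 3 W.Δ = 10 := by
    rw [← cast_minimalDiscriminantInt, padicValRat.of_int]; exact_mod_cast hv
  have h1728 : padicValRat 3 (1728 : ℚ) = 3 := by
    have h := padicValRat_three_pow_mul 3 64 (by norm_num)
    norm_num at h
    exact_mod_cast h
  have hrel : W.c₄ ^ 3 = W.c₆ ^ 2 + 1728 * W.Δ := by linear_combination -W.c_relation
  have hv1 : padicValRat 3 (W.c₆ ^ 2) = 12 := by rw [padicValRat.pow, hv6]; norm_num
  have hv2 : padicValRat 3 (1728 * W.Δ) = 13 := by
    rw [padicValRat.mul (by norm_num) hΔ, h1728, hvΔ]; norm_num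
  have hsum : W.c₆ ^ 2 + 1728 * W.Δ ≠ 0 := by
    intro h0
    have e : W.c₆ ^ 2 = -(1728 * W.Δ) := by linear_combination h0
    have := congrArg (padicValRat 3) e
    rw [padicValRat.neg, hv1, hv2] at this
    norm_num at this
  have h₄ : W.c₄ ≠ 0 := by
    intro h0
    rw [h0, zero_pow three_ne_zero] at hrel
    exact hsum hrel.symm
  refine ⟨h₄, h₆, ?_⟩
  have hmin := padicValRat.min_le_padicValRat_add (p := 3) hsum
  rw [hv1, hv2, ← hrel, padicValRat.pow] at hmin
  norm_num at hmin
  omega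

/-- **The Kodaira-`IV*` rows (`v₃Δ_min = 10`) are a one-stable-line locus**: `Ψ₃` has exactly one root in
`ℚ₃`. [cite: SilvermanATAEC1994, IV.9.4 Step 8] [cite: Serre1972, §1.11] -/
theorem exists_isUniqueStableLineThree_of_kodairaIVstar (hK : W.kodairaSymbolAt (placeOf 3) = .IVstar)
    (hv : padicValInt 3 W.minimalDiscriminantInt = 10) : ∃ x₀, IsUniqueStableLineThree W x₀ := by
  obtain ⟨h₄, h₆, h4⟩ := c₄_c₆_of_kodairaIVstar W hK hv
  have hv6 := padicValRat_c₆_eq_six_of_kodairaIVstar W hK hv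
  have hord : W.ordMinimalDiscriminant (placeOf 3) = 10 := by
    rw [ordMinimalDiscriminant_placeOf_eq W 3, hv]
  obtain ⟨x, hx⟩ := exists_isRoot_Ψ₃_padic_of_le W h₄ h₆ (by rw [hv6]; omega)
  exact ⟨x, hx, fun r hr ↦ Ψ₃_root_unique_padic_of_kodairaIVstar W hK hord r x hr hx⟩

/-- **The `ℚ₃` square class of `c₆` on the `IV*` rows**: the unit part of `c₆` is `≡ 1 (mod 3)` iff
`c₆(W_ℤ)/3⁶ % 3 = 1` (`v₃c₆ = 6` is even, so this is `IsSquare (c₆ : ℚ₃)`). [cite: Serre1973, Ch. II §3.3] -/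
theorem unitPartCongThree_c₆_one_iff_of_kodairaIVstar (hK : W.kodairaSymbolAt (placeOf 3) = .IVstar)
    (hv : padicValInt 3 W.minimalDiscriminantInt = 10) :
    UnitPartCongThree (W.c₆ : ℚ_[3]) 1 ↔ (integralModelInt W).c₆ / 3 ^ 6 % 3 = 1 := by
  obtain ⟨-, h₆, -⟩ := c₄_c₆_of_kodairaIVstar W hK hv
  have h5 := PSTamagawaThree.padicValInt_c₆_eq_six_of_kodairaIVstar W hK hv
  have hv6 := padicValRat_c₆_eq_six_of_kodairaIVstar W hK hv
  set n : ℤ := (integralModelInt W).c₆ with hn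
  have hcast : (W.c₆ : ℚ_[3]) = ((n : ℚ) : ℚ_[3]) := by rw [hn, cast_integralModelInt_c₆]
  have hc₆' : (W.c₆ : ℚ_[3]) ≠ 0 := by exact_mod_cast h₆
  have hsq : IsSquare (W.c₆ : ℚ_[3]) ↔ UnitPartCongThree (W.c₆ : ℚ_[3]) 1 := by
    rw [isSquare_iff_even_valuation_and_unitPartCongThree_one hc₆', Padic.valuation_ratCast, hv6]
    exact ⟨fun h ↦ h.2, fun h ↦ ⟨⟨3, by norm_num⟩, h⟩⟩
  have hdvd : (3 : ℤ) ^ 6 ∣ n := by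
    have := padicValInt_dvd (p := 3) n
    rw [h5] at this; exact_mod_cast this
  have h7 : ¬ (3 : ℤ) ^ (6 + 1) ∣ n := by
    intro h
    have hn0 : n ≠ 0 := by
      intro h0; rw [h0] at h5; simp at h5
    have := (padicValInt_dvd_iff (6 + 1) n).mp (by exact_mod_cast h)
    rw [h5] at this
    omega
  rw [← hsq, hcast, Rat.cast_intCast, isSquare_intCast_padic_three_iff n 6 hdvd h7]
  omega

/-- **HEADLINE: the `IV*` rows are ORD-side, ORDM iff `c₆(W_ℤ)/3⁶ % 3 = 1`, ORD1 iff `c₆(W_ℤ)/3⁶ % 3 = 2`.**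
[cite: Serre1972, §1.11] [cite: Kraus1990, Théorème (p = 3)] -/
theorem shapeOrdSideThree_of_kodairaIVstar (hK : W.kodairaSymbolAt (placeOf 3) = .IVstar)
    (hv : padicValInt 3 W.minimalDiscriminantInt = 10) :
    ShapeOrdSideThree W ∧
      (ShapeORDMThree W ↔ (integralModelInt W).c₆ / 3 ^ 6 % 3 = 1) ∧
      (ShapeORD1Three W ↔ (integralModelInt W).c₆ / 3 ^ 6 % 3 = 2) := by
  have h1 := exists_isUniqueStableLineThree_of_kodairaIVstar W hK hv
  have hv6 := padicValRat_c₆_eq_six_of_kodairaIVstar W hK hv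
  have h5 := PSTamagawaThree.padicValInt_c₆_eq_six_of_kodairaIVstar W hK hv
  obtain ⟨-, h₆, -⟩ := c₄_c₆_of_kodairaIVstar W hK hv
  have hev : Even (padicValRat 3 W.c₆) := by rw [hv6]; exact ⟨3, by norm_num⟩
  have hupc := unitPartCongThree_c₆_one_iff_of_kodairaIVstar W hK hv
  have hORDM : ShapeORDMThree W ↔ (integralModelInt W).c₆ / 3 ^ 6 % 3 = 1 := by
    rw [shapeORDMThree_iff W h1, ← hupc]
    exact ⟨fun h ↦ h.2, fun h ↦ ⟨hev, h⟩⟩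
  -- `3 ∤ c₆/3⁶`, so the residue is `1` or `2`
  set n : ℤ := (integralModelInt W).c₆ with hn
  have hres : n / 3 ^ 6 % 3 = 1 ∨ n / 3 ^ 6 % 3 = 2 := by
    have hdvd : (3 : ℤ) ^ 6 ∣ n := by
      have := padicValInt_dvd (p := 3) n
      rw [h5] at this; exact_mod_cast this
    obtain ⟨m, hm⟩ := hdvd
    have hm3 : ¬ (3 : ℤ) ∣ m := by
      rintro ⟨k, rfl⟩
      have h7 : ((3 : ℕ) : ℤ) ^ 7 ∣ n := ⟨k, by rw [hm]; ring⟩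
      have hn0 : n ≠ 0 := by
        intro h0; rw [h0] at h5; simp at h5
      have := (padicValInt_dvd_iff 7 n).mp h7
      rw [h5] at this
      omega
    rw [hm, Int.mul_ediv_cancel_left _ (by norm_num)]
    omega
  have hc₆' : (W.c₆ : ℚ_[3]) ≠ 0 := by exact_mod_cast h₆
  have hORD1 : ShapeORD1Three W ↔ n / 3 ^ 6 % 3 = 2 := by
    rw [shapeORD1Three_iff W h1]
    constructor
    · rintro ⟨-, hm1⟩
      rcases hres with h | h
      · exact absurd ⟨hupc.mpr h, hm1⟩ (unitPartCongThree_not_both _)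
      · exact h
    · intro h2
      refine ⟨hev, ?_⟩
      rcases unitPartCongThree_one_or_neg_one hc₆' with h | h
      · have := hupc.mp h; omega
      · exact h
  refine ⟨?_, hORDM, hORD1⟩
  rcases hres with h | h
  · exact Or.inr (hORDM.mpr h)
  · exact Or.inl (hORD1.mpr h)

/-- **ORDM ⟺ `c₃ = 3` on the principal-series `IV*` rows** (`ClassO6 W 3`, `v = 10`, `Δ_min/3¹⁰ ≡ 1 (mod 3)`):
the stable line is `μ₃ ⊗`(unramified quadratic) exactly when the Néron component group at `3` has order `3`
(this seat's LAW L-c3 `localTamagawaNumber_three_eq_three_iff_of_kodairaIVstar`: `c₃ = 3 ⟺ (Δ_min/3¹⁰)(c₆/3⁶) ≡ 1`).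
[cite: SilvermanATAEC1994, IV.9.4 Step 8] [cite: Serre1972, §1.11] -/
theorem shapeORDMThree_iff_localTamagawaNumber_eq_three_of_psRow_ten (hO6 : ClassO6 W 3)
    (h10 : padicValInt 3 W.minimalDiscriminantInt = 10)
    (hps : W.minimalDiscriminantInt / 3 ^ padicValInt 3 W.minimalDiscriminantInt % 3 = 1) :
    ShapeOrdSideThree W ∧
      (ShapeORDMThree W ↔ (W.baseChange ℚ_[3]).localTamagawaNumber ℤ_[3] = 3) := by
  obtain ⟨-, hadd, hW⟩ := hO6
  rcases PSKodairaDictionary.kodairaSymbolAt_of_mod_four_eq_two W hadd hW (by omega) with ⟨-, h⟩ | ⟨hK, -⟩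
  · omega
  · obtain ⟨hord, hORDM, -⟩ := shapeOrdSideThree_of_kodairaIVstar W hK h10
    refine ⟨hord, ?_⟩
    rw [hORDM, PSTamagawaThree.localTamagawaNumber_three_eq_three_iff_of_kodairaIVstar W hK h10]
    rw [h10] at hps
    rw [Int.mul_emod, hps, one_mul, Int.emod_emod_of_dvd _ (dvd_refl (3 : ℤ))]

end Curves

end Summit.BirchSwinnertonDyer.BirchSwinnertonDyer.Theorems.PSLocalThreeTorsion

end
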